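import Summits.CriticalPhenomena.Ising3DConformalLimit.Theorems.HarmonicMomentsIsotropyTwoPointAsymptoticIsotropyPairLimit
import HarnessLib

/-!
# Crux `IsingEuclidUpgradeR2RotInvPowerLaw` (stmt-CriticalPhenomena-0634), line `tower_profile_rigidity`,
# variant V: bulk convergence of rescaled lattice sums along a SUBSEQUENTIAL pair scaling limit

Write `G := criticalTwoPoint 3` for the critical two-point function `⟨σ₀σ_x⟩_{β_c}` of the
nearest-neighbour Ising model on `ℤ³`. Variant V of the line passes vague `O(3)`-isotropy to the limit
along a subsequential pair scaling limit: a mesh sequence `u k → 0⁺` along which the renormalised pair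
correlator `ρ(u k)² G([a/u k], [b/u k])` converges to `S2 (a, b)` locally uniformly off the diagonal.
The main result of this file, `tendsto_scaled_latticeSum_seq`, is the sequential form of the tree
theorem `tendsto_scaled_latticeSum₂` (file `…TwoPointAsymptoticIsotropyPairLimit`, full filter `𝓝[>] 0`):
for every bounded `Ψ : ℝ³ → ℝ` which is continuous almost everywhere and vanishes on `{‖y‖ < ε}`
(`ε > 0`) and on `{‖y‖ > M}`,

  `(u k)³ ρ(u k)² Σ_{x ∈ ℤ³} Ψ((u k) x) G(x)  →  ∫_{ℝ³} Ψ(y) S2(0, y) dy`   as `k → ∞`.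

Proof (that of `tendsto_scaled_latticeSum₂` with `𝓝[>] 0` replaced by `atTop` along `u`): the lattice
sum is the integral of the step function `y ↦ Ψ((u k)[y/u k]) · ρ(u k)² G([y/u k])`
(`cube_mul_tsum_eq_integral`); off the origin and the discontinuity set of `Ψ` it converges pointwise,
and it is dominated by a constant multiple of the indicator of a ball because the rescaled pair
correlators are uniformly bounded on the compact shell `{ε/2 ≤ ‖y‖ ≤ M + 1}` for large `k` (uniform
convergence on compacts and `|⟨σσ⟩| ≤ 1`); dominated convergence along the countably generated filter
`atTop`. References: G. B. Folland, *Real Analysis* (1999), Thm. 2.24 (dominated convergence);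
H. Duminil-Copin, ICM 2022, §8.1 (context). No definitions are introduced.
-/

noncomputable section

namespace Summit.CriticalPhenomena.Ising3DConformalLimit.Cruxes.IsingEuclidUpgradeR2RotInvPowerLaw.TowerProfileRigidity

open Literature.Probability.LatticeModels MeasureTheory Filter Set Metric
open scoped Topology
open Summit.CriticalPhenomena.Ising3DConformalLimit.HyperoctahedralRPTwoPoint
open Summit.CriticalPhenomena.Ising3DConformalLimit.HarmonicMomentsIsotropyTwoPoint

/-! ### Uniform bounds along a subsequential pair limit -/

/-- Uniform boundedness of the rescaled pair correlators on a compact set of non-coincident pairs,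
for all large `k`, along a subsequential pair scaling limit (uniform convergence on compacts and
`|⟨σσ⟩| ≤ 1`; the sequential form of `exists_eventually_rescaled_two_le₂`). [folklore] -/
theorem exists_eventually_rescaled_two_le_seq {ρ : ℝ → ℝ} {u : ℕ → ℝ}
    {S2 : (Fin 2 → EuclideanSpace ℝ (Fin 3)) → ℝ}
    (hconv2 : TendstoLocallyUniformlyOn (fun k => rescaledCorrelator (criticalCorr 3) ρ 2 (u k)) S2
      atTop (NonCoincident 3 2))
    {K : Set (Fin 2 → EuclideanSpace ℝ (Fin 3))} (hK : IsCompact K) (hKs : K ⊆ NonCoincident 3 2) :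
    ∃ C : ℝ, ∀ᶠ k in atTop, ∀ z ∈ K, rescaledCorrelator (criticalCorr 3) ρ 2 (u k) z ≤ C := by
  have hU : TendstoUniformlyOn (fun k => rescaledCorrelator (criticalCorr 3) ρ 2 (u k)) S2 atTop K :=
    (tendstoLocallyUniformlyOn_iff_forall_isCompact (isOpen_nonCoincident 3 2)).1 hconv2 K hKs hK
  have h1 : ∀ᶠ k in atTop, ∀ z ∈ K,
      dist (S2 z) (rescaledCorrelator (criticalCorr 3) ρ 2 (u k) z) < 1 :=
    Metric.tendstoUniformlyOn_iff.1 hU 1 one_pos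
  obtain ⟨k₁, hk₁⟩ := h1.exists
  refine ⟨ρ (u k₁) ^ 2 + 2, h1.mono fun k hk z hz => ?_⟩
  have hb : rescaledCorrelator (criticalCorr 3) ρ 2 (u k₁) z ≤ ρ (u k₁) ^ 2 := by
    rw [rescaledCorrelator_apply]
    calc ρ (u k₁) ^ 2 * criticalCorr 3 2 (fun i => latticeApprox (u k₁) (z i))
        ≤ ρ (u k₁) ^ 2 * 1 := mul_le_mul_of_nonneg_left
          ((le_abs_self _).trans (abs_criticalCorr_le_one le_rfl _ _)) (sq_nonneg _)
      _ = ρ (u k₁) ^ 2 := mul_one _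
  have e1 := abs_sub_lt_iff.1 (Real.dist_eq _ _ ▸ hk₁ z hz)
  have e2 := abs_sub_lt_iff.1 (Real.dist_eq _ _ ▸ hk z hz)
  linarith [e1.1, e1.2, e2.1, e2.2]

/-- Uniform boundedness of the rescaled two-point function on a closed shell `{ε ≤ ‖y‖ ≤ M}`
(`ε > 0`), for all large `k`, along a subsequential pair scaling limit (the sequential form of
`exists_eventually_rescaled_twoPoint_le₂`). [folklore] -/
theorem exists_eventually_rescaled_twoPoint_le_seq {ρ : ℝ → ℝ} {u : ℕ → ℝ}
    {S2 : (Fin 2 → EuclideanSpace ℝ (Fin 3)) → ℝ}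
    (hconv2 : TendstoLocallyUniformlyOn (fun k => rescaledCorrelator (criticalCorr 3) ρ 2 (u k)) S2
      atTop (NonCoincident 3 2))
    {ε M : ℝ} (hε : 0 < ε) :
    ∃ C : ℝ, 0 ≤ C ∧ ∀ᶠ k in atTop, ∀ y : EuclideanSpace ℝ (Fin 3), ε ≤ ‖y‖ → ‖y‖ ≤ M →
      ρ (u k) ^ 2 * criticalTwoPoint 3 (latticeApprox (u k) y) ≤ C := by
  set Q : Set (EuclideanSpace ℝ (Fin 3)) := {y | ε ≤ ‖y‖ ∧ ‖y‖ ≤ M} with hQ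
  have hQc : IsCompact Q := by
    refine Metric.isCompact_of_isClosed_isBounded ?_ ?_
    · exact (isClosed_le continuous_const continuous_norm).inter
        (isClosed_le continuous_norm continuous_const)
    · refine (isBounded_closedBall (x := (0 : EuclideanSpace ℝ (Fin 3))) (r := M)).subset ?_
      intro y hy
      rw [mem_closedBall, dist_zero_right]
      exact hy.2
  set K : Set (Fin 2 → EuclideanSpace ℝ (Fin 3)) :=
    (fun y : EuclideanSpace ℝ (Fin 3) => (![0, y] : Fin 2 → EuclideanSpace ℝ (Fin 3))) '' Q with hK
  have hKc : IsCompact K := hQc.image continuous_zeroPair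
  have hKs : K ⊆ NonCoincident 3 2 := by
    rintro _ ⟨y, hy, rfl⟩
    refine zero_pair_mem_nonCoincident fun h0 => ?_
    have hy' : ε ≤ ‖y‖ := hy.1
    rw [h0, norm_zero] at hy'
    linarith
  obtain ⟨C, hC⟩ := exists_eventually_rescaled_two_le_seq hconv2 hKc hKs
  refine ⟨max C 0, le_max_right _ _, hC.mono fun k hk y hy1 hy2 => ?_⟩
  have h := hk (![0, y] : Fin 2 → EuclideanSpace ℝ (Fin 3)) ⟨y, ⟨hy1, hy2⟩, rfl⟩
  rw [rescaledCorrelator_zero_pair] at h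
  exact h.trans (le_max_left _ _)

/-! ### Bulk convergence of rescaled lattice sums along a subsequential pair limit -/

/-- **Bulk convergence of rescaled lattice sums along a subsequential pair scaling limit.** If
`u k → 0⁺` and the renormalised critical pair correlator at mesh `u k` converges locally uniformly off
the diagonal to `S2`, and `Ψ : ℝ³ → ℝ` is bounded, continuous almost everywhere, and vanishes on
`{‖y‖ < ε}` (`ε > 0`) and on `{‖y‖ > M}`, then
`(u k)³ ρ(u k)² Σ_{x ∈ ℤ³} Ψ((u k) x) ⟨σ₀σ_x⟩_{β_c} → ∫ Ψ(y) S2(0, y) dy` as `k → ∞` (the proof of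
`tendsto_scaled_latticeSum₂` along the sequence: the lattice sum is the integral of a step function
converging pointwise off a null set and dominated on the compact shell `{ε/2 ≤ ‖y‖ ≤ M+1}`).
[cite: Folland1999, Thm. 2.24 (dominated convergence)] -/
theorem tendsto_scaled_latticeSum_seq : ∀ {ρ : ℝ → ℝ} {u : ℕ → ℝ}, Filter.Tendsto u Filter.atTop (nhdsWithin (0:ℝ) (Set.Ioi 0)) → ∀ {S2 : (Fin 2 → EuclideanSpace ℝ (Fin 3)) → ℝ}, TendstoLocallyUniformlyOn (fun k => Literature.Probability.LatticeModels.rescaledCorrelator (Literature.Probability.LatticeModels.criticalCorr 3) ρ 2 (u k)) S2 Filter.atTop (Literature.Probability.LatticeModels.NonCoincident 3 2) → ∀ {Ψ : EuclideanSpace ℝ (Fin 3) → ℝ} {B ε M : ℝ}, (∀ y, |Ψ y| ≤ B) → 0 < ε → (∀ y, ‖y‖ < ε → Ψ y = 0) → (∀ y, M < ‖y‖ → Ψ y = 0) → (∀ᶠ y in MeasureTheory.ae (MeasureTheory.volume : MeasureTheory.Measure (EuclideanSpace ℝ (Fin 3))), ContinuousAt Ψ y) → Filter.Tendsto (fun k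 : ℕ => (u k) ^ 3 * ρ (u k) ^ 2 * ∑' x : Literature.Probability.LatticeModels.Site 3, Ψ ((u k) • Literature.Probability.LatticeModels.siteVec x) * Literature.Probability.LatticeModels.criticalTwoPoint 3 x) Filter.atTop (nhds (∫ y, Ψ y * S2 ![0, y])) := by
  intro ρ u hu S2 hconv2 Ψ B ε M hB hε hΨε hΨM hcont
  -- the mesh is eventually positive and small
  have hpos : ∀ᶠ k in atTop, u k ∈ Ioi (0:ℝ) := hu.eventually_mem self_mem_nhdsWithin
  have hsmall : ∀ᶠ k in atTop, u k < min (ε / 4) (1 / 2) :=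
    hu.eventually ((eventually_lt_nhds (by positivity)).filter_mono nhdsWithin_le_nhds)
  -- the step functions
  set F : ℕ → EuclideanSpace ℝ (Fin 3) → ℝ := fun k y =>
    Ψ ((u k) • siteVec (latticeApprox (u k) y)) *
      (ρ (u k) ^ 2 * criticalTwoPoint 3 (latticeApprox (u k) y)) with hF
  have hB0 : 0 ≤ B := (abs_nonneg _).trans (hB 0)
  -- Step 1: the lattice sum is the integral of the step function
  have heq : (fun k : ℕ => ∫ y, F k y) =ᶠ[atTop] fun k => (u k) ^ 3 * ρ (u k) ^ 2 *
      ∑' x : Site 3, Ψ ((u k) • siteVec x) * criticalTwoPoint 3 x := by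
    filter_upwards [hpos] with k hk
    rw [show (u k) ^ 3 * ρ (u k) ^ 2 * ∑' x : Site 3, Ψ ((u k) • siteVec x) * criticalTwoPoint 3 x =
      ρ (u k) ^ 2 * ((u k) ^ 3 * ∑' x : Site 3, Ψ ((u k) • siteVec x) * criticalTwoPoint 3 x) by ring,
      cube_mul_tsum_eq_integral (mem_Ioi.1 hk) hΨM, ← integral_const_mul]
    refine integral_congr_ae (Eventually.of_forall fun y => ?_)
    simp only [hF]
    ring
  -- Step 2: the uniform bound on the shell `ε/2 ≤ ‖y‖ ≤ M + 1`
  obtain ⟨C, hC0, hC⟩ := exists_eventually_rescaled_twoPoint_le_seq hconv2 (ε := ε / 2) (M := M + 1)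
    (half_pos hε)
  set bound : EuclideanSpace ℝ (Fin 3) → ℝ :=
    (closedBall (0 : EuclideanSpace ℝ (Fin 3)) (M + 1)).indicator fun _ => B * C with hbound
  have h_bound : ∀ᶠ k in atTop, ∀ᵐ y ∂(volume : Measure (EuclideanSpace ℝ (Fin 3))),
      ‖F k y‖ ≤ bound y := by
    filter_upwards [hC, hsmall, hpos] with k hCk hks hkpos
    refine Eventually.of_forall fun y => ?_
    have hδ : 0 < u k := hkpos
    have hδε : u k < ε / 4 := hks.trans_le (min_le_left _ _)
    have hδ1 : u k < 1 / 2 := hks.trans_le (min_le_right _ _)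
    set p := (u k) • siteVec (latticeApprox (u k) y) with hp
    by_cases hΨp : Ψ p = 0
    · have : F k y = 0 := by simp only [hF, ← hp, hΨp, zero_mul]
      rw [this, norm_zero, hbound]
      exact Set.indicator_nonneg (fun _ _ => mul_nonneg hB0 hC0) _
    · have hpε : ε ≤ ‖p‖ := not_lt.1 fun h => hΨp (hΨε p h)
      have hpM : ‖p‖ ≤ M := not_lt.1 fun h => hΨp (hΨM p h)
      have hdist : ‖p - y‖ ≤ 2 * u k := norm_smul_siteVec_latticeApprox_sub_le hδ y
      have hy1 : ε / 2 ≤ ‖y‖ := by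
        have := norm_sub_norm_le p y
        linarith
      have hy2 : ‖y‖ ≤ M + 1 := by
        have := norm_sub_norm_le y p
        rw [norm_sub_rev] at this
        linarith
      have hG := hCk y hy1 hy2
      have hG0 : 0 ≤ ρ (u k) ^ 2 * criticalTwoPoint 3 (latticeApprox (u k) y) :=
        mul_nonneg (sq_nonneg _) (criticalTwoPoint_nonneg' _)
      have hmem : y ∈ closedBall (0 : EuclideanSpace ℝ (Fin 3)) (M + 1) := by
        rw [mem_closedBall, dist_zero_right]; exact hy2
      rw [hbound, indicator_of_mem hmem, hF]
      simp only [← hp]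
      rw [norm_mul, Real.norm_eq_abs, Real.norm_eq_abs, abs_of_nonneg hG0]
      exact mul_le_mul (hB p) hG hG0 hB0
  -- Step 3: measurability and integrability of the bound
  have h_meas : ∀ᶠ k in atTop,
      AEStronglyMeasurable (F k) (volume : Measure (EuclideanSpace ℝ (Fin 3))) := by
    refine Eventually.of_forall fun k => ?_
    have hg : Measurable fun x : Site 3 =>
        Ψ ((u k) • siteVec x) * (ρ (u k) ^ 2 * criticalTwoPoint 3 x) := measurable_of_countable _
    exact (hg.comp (measurable_latticeApprox (u k))).aestronglyMeasurable
  have h_int : Integrable bound (volume : Measure (EuclideanSpace ℝ (Fin 3))) := by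
    rw [hbound, integrable_indicator_iff measurableSet_closedBall]
    exact integrableOn_const (measure_closedBall_lt_top.ne)
  -- Step 4: pointwise convergence off the null set `{0} ∪ {discontinuities of Ψ}`
  have h_ne : ∀ᵐ y ∂(volume : Measure (EuclideanSpace ℝ (Fin 3))),
      y ≠ (0 : EuclideanSpace ℝ (Fin 3)) := by
    rw [ae_iff]
    simp
  have h_lim : ∀ᵐ y ∂(volume : Measure (EuclideanSpace ℝ (Fin 3))),
      Tendsto (fun k => F k y) atTop (𝓝 (Ψ y * S2 ![0, y])) := by
    filter_upwards [hcont, h_ne] with y hcy hy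
    have h1 : Tendsto (fun k : ℕ => Ψ ((u k) • siteVec (latticeApprox (u k) y))) atTop (𝓝 (Ψ y)) :=
      hcy.tendsto.comp ((tendsto_smul_siteVec_latticeApprox y).comp hu)
    have h2 : Tendsto (fun k : ℕ => ρ (u k) ^ 2 * criticalTwoPoint 3 (latticeApprox (u k) y)) atTop
        (𝓝 (S2 ![0, y])) := by
      have h := hconv2.tendsto_at (zero_pair_mem_nonCoincident hy)
      simp_rw [rescaledCorrelator_zero_pair] at h
      exact h
    exact h1.mul h2
  have hmain := tendsto_integral_filter_of_dominated_convergence bound h_meas h_bound h_int h_lim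
  exact hmain.congr' heq

end Summit.CriticalPhenomena.Ising3DConformalLimit.Cruxes.IsingEuclidUpgradeR2RotInvPowerLaw.TowerProfileRigidity

end
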